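import Summits.Ventures.CertifiedQuantumChemistry.Rows.LiebSingletBridge
import Summits.HubbardSuperconductivity.HubbardSuperconductivity.Theorems.CooperPairDMottWalkPlaquetteGramCert
import HarnessLib

/-!
# Ventures/CertifiedQuantumChemistry — Rows/HubbardRingKernel.lean: kernel replay of TV-H rows (typer aside T-06b)

HONEST FRAMING (verbatim): certified bounds for a stated model Hamiltonian in a stated basis; not a
claim about the real molecule beyond that model.

The S0-H rows of `CERTIFIED.md` on the Hubbard-ring test vectors TV-H (`hubbardRingTV L 1 U`,
`L = 4` sector `(2,2)`, `L = 6` sector `(3,3)`, `U/t ∈ {1, 10, 10², 10³, 10⁴}`) are carried in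
`Certificates/HubbardRing*.lean` by CLAIM NODES (`@[conjecture] def cert_… : Prop`, verified outside the
kernel by the readers and the referee). At these sizes (sector dimensions `36` and `400`) the row
predicates can instead be PROVED BY THE LEAN KERNEL — a certified exact diagonalisation in Lieb's
two-species sector coordinates, the device of the tree's plaquette computation
(`Summits/HubbardSuperconductivity/…/CooperPairDMottWalkPlaquette*.lean`; Lieb, PRL 62 (1989), eq. (4)):

* T-06 (`Rows/LiebSingletBridge.lean`): `(hubbardRingTV L 1 U).hamiltonian = hamiltonian (ringGraph L) 1 U`;
* `Literature…TwoSpecies.re_sector_hamiltonian_eq`: for `ψ` in the sector `(a, b)`, with enumerations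
  `sa`, `sb` of the `a`-element and `b`-element subsets of `Fin L` and INTEGER tables `Ka`, `Kb` (spinless hopping with
  Jordan–Wigner signs, `= hoppingMatrix (ringGraph L) 1` on the enumerated subsets) and `d`
  (double occupancies `|sa i ∩ sb j|`), `Re ⟨ψ, ψ⟩ = normSqW W(ψ)` and
  `Re ⟨ψ, H(U) ψ⟩ = hopForm Ka Kb W(ψ) + U · dblForm d W(ψ)`;
* UPPER (`hubbardRingTV_upperCertificate_of_trial`): an integer trial array `v` with
  `hopZ v + U · dblZ v ≤ hi · nsqZ v` (three integers, `decide`) IS an `UpperCertificate … a b hi`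
  (witness `ofSectorArray sa sb v`), i.e. it DISCHARGES an upper claim node;
* LOWER (`hubbardRingTV_lowerRow_of_ddCheckP`): the rounded-Gram / diagonal-dominance check `ddCheckP`
  of `…PlaquetteGramCert` on the integer matrix `bMatP Ka Kb d N (N·U) m` (kernel-evaluated on an
  untrusted integer factor `G`) gives `(m/N) ‖x‖² ≤ hopR x + U dblR x` for all real arrays, hence —
  through the sector ground state (`exists_unit_eigen_sectorGroundEnergy`) — `LowerRow … a b lo` for
  every `lo ≤ m/N`. This proves the ROW (`LowerRow`); the SDP claim node (`LowerCertificate`, the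
  existence of a v2RDM dual of the stated shape) stays what it is.

This file: the generic assembly for any `L`, `(a, b)` and tables; the literal tables for `L = 4`,
`n = 2` (`r4s2`, `r4K2`, `r4d22`) and `L = 6`, `n = 3` (`r6s3`, `r6K3`, `r6d33`), checked against the
definitions by `decide +kernel`; and the `L`-specialised entry points used by the
`Certificates/HubbardRingL{4,6}Kernel*.lean` files (untrusted data + discharged nodes).
0 `sorry`, no new `def … : Prop`.

References: E. H. Lieb, PRL 62 (1989) 1201, eq. (4) [LiebPRL1989]; S. M. Rump, Acta Numerica 19 (2010)
287–449, §10.8 (rounded Cholesky factor + residual bound; the device of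
`Literature/LinearAlgebra/Matrix/GramCertificateCheck.lean`). Typer `pub-qchem-typer` (gen 3), 0 core-h.
-/

namespace Summit.Ventures.CertifiedQuantumChemistry

open Matrix Finset
open Literature.MathematicalPhysics.QuantumLattice Literature.MathematicalPhysics.QuantumChemistry
open Literature.MathematicalPhysics.QuantumLattice.TwoSpecies
open Summit.Ventures.CertifiedQuantumChemistry.Hamiltonians
open Summit.HubbardSuperconductivity.HubbardSuperconductivity.Theorems.CooperPairDMottWalk
open scoped ComplexOrder

/-! ## Generic assembly: TV-H rows from sector coordinates -/

section Generic

variable {L p q a b : ℕ} {sa : Fin p → Finset (Fin L)} {sb : Fin q → Finset (Fin L)}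
  {Ka : Fin p → Fin p → ℤ} {Kb : Fin q → Fin q → ℤ} {d : Fin p → Fin q → ℕ}

/-- T-06 at `t = 1`: the TV-H Hamiltonian is the graph Hubbard Hamiltonian of the ring with hopping `1`. -/
theorem hubbardRingTV_hamiltonian_eq_one (L : ℕ) (U : ℚ) :
    (hubbardRingTV L 1 U).hamiltonian = hamiltonian (ringGraph L) 1 (U : ℝ) := by
  rw [hubbardRingTV_hamiltonian_eq, Rat.cast_one]

/-- The sector forms of the TV-H model: for `ψ` in the sector `(a, b)`,
`Re ⟨ψ, ψ⟩ = normSqW W(ψ)` and `Re ⟨ψ, H_F ψ⟩ = hopForm Ka Kb W(ψ) + U · dblForm d W(ψ)` whenever the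
integer tables match the hopping entries and double occupancies of the enumerated subsets. -/
theorem hubbardRingTV_sector_forms (ha : IsSubsetEnum a sa) (hb : IsSubsetEnum b sb)
    (hKa : ∀ i i', hoppingMatrix (ringGraph L) 1 (sa i) (sa i') = (Ka i i' : ℂ))
    (hKb : ∀ j j', hoppingMatrix (ringGraph L) 1 (sb j) (sb j') = (Kb j j' : ℂ))
    (hd : ∀ i j, (sa i ∩ sb j).card = d i j) (U : ℚ) {ψ : Fock (Orb (Fin L))}
    (hψ : IsInSector a b ψ) :
    (star ψ ⬝ᵥ ψ).re = normSqW (fun i j => coeffMatrix ψ (sa i) (sb j)) ∧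
      (star ψ ⬝ᵥ (hubbardRingTV L 1 U).hamiltonian *ᵥ ψ).re =
        hopForm Ka Kb (fun i j => coeffMatrix ψ (sa i) (sb j)) +
          (U : ℝ) * dblForm d (fun i j => coeffMatrix ψ (sa i) (sb j)) := by
  refine ⟨re_sector_norm_eq ha hb hψ, ?_⟩
  rw [hubbardRingTV_hamiltonian_eq_one]
  exact re_sector_hamiltonian_eq (ringGraph L) ha hb 1 (U : ℝ) hKa hKb hd hψ

/-- **UPPER rows by an integer trial array.** If the integers of a trial array `v` of the sector
`(a, b)` satisfy `hopZ v + U · dblZ v ≤ hi · nsqZ v` (and `v ≠ 0`), then the explicit sector vector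
`ofSectorArray sa sb v` is an `UpperCertificate (hubbardRingTV L 1 U) a b hi` (Rayleigh–Ritz). -/
theorem hubbardRingTV_upperCertificate_of_trial (ha : IsSubsetEnum a sa) (hb : IsSubsetEnum b sb)
    (hKa : ∀ i i', hoppingMatrix (ringGraph L) 1 (sa i) (sa i') = (Ka i i' : ℂ))
    (hKb : ∀ j j', hoppingMatrix (ringGraph L) 1 (sb j) (sb j') = (Kb j j' : ℂ))
    (hd : ∀ i j, (sa i ∩ sb j).card = d i j) (U hi : ℚ) (v : Fin p → Fin q → ℤ)
    (hv : 0 < nsqZ v)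
    (hle : ((hopZ Ka Kb v : ℤ) : ℚ) + U * ((dblZ d v : ℤ) : ℚ) ≤ hi * ((nsqZ v : ℤ) : ℚ)) :
    UpperCertificate (hubbardRingTV L 1 U) a b hi := by
  set ψ : Fock (Orb (Fin L)) := ofSectorArray sa sb (fun i j => ((v i j : ℤ) : ℂ)) with hψdef
  have hψ : IsInSector a b ψ := isInSector_ofSectorArray ha hb _
  have hw : (fun i j => coeffMatrix ψ (sa i) (sb j)) = fun i j => ((v i j : ℤ) : ℂ) :=
    funext fun i => funext fun j => coeffMatrix_ofSectorArray ha hb _ i j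
  obtain ⟨hn, hH⟩ := hubbardRingTV_sector_forms ha hb hKa hKb hd U hψ
  rw [hw, normSqW_intCast] at hn
  rw [hw, hopForm_intCast, dblForm_intCast] at hH
  refine ⟨ψ, hψ, ?_, ?_⟩
  · intro h0
    have h1 : (star ψ ⬝ᵥ ψ).re = 0 := by rw [h0, dotProduct_zero, Complex.zero_re]
    rw [hn] at h1
    have hv' : (0 : ℝ) < ((nsqZ v : ℤ) : ℝ) := by exact_mod_cast hv
    exact absurd h1 (ne_of_gt hv')
  · rw [hH, hn]
    have := (Rat.cast_le (K := ℝ)).2 hle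
    push_cast at this
    exact this

/-- **LOWER rows from a bound on the real sector form.** If `lo · ‖x‖² ≤ hopR x + U · dblR x` for
every real array `x` of the sector shape, then `LowerRow (hubbardRingTV L 1 U) a b lo` (the sector
ground state exists and its Rayleigh quotient is the sector energy; real and imaginary parts). -/
theorem hubbardRingTV_lowerRow_of_formBound (ha : IsSubsetEnum a sa) (hb : IsSubsetEnum b sb)
    (hKa : ∀ i i', hoppingMatrix (ringGraph L) 1 (sa i) (sa i') = (Ka i i' : ℂ))
    (hKb : ∀ j j', hoppingMatrix (ringGraph L) 1 (sb j) (sb j') = (Kb j j' : ℂ))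
    (hd : ∀ i j, (sa i ∩ sb j).card = d i j) (haL : a ≤ L) (hbL : b ≤ L) (U lo : ℚ)
    (h : ∀ x : Fin p → Fin q → ℝ, ((lo : ℚ) : ℝ) * nsqR x ≤ hopR Ka Kb x + ((U : ℚ) : ℝ) * dblR d x) :
    LowerRow (hubbardRingTV L 1 U) a b lo := by
  refine ⟨haL, hbL, ?_⟩
  have hF := hubbardRingTV_isSymmetric L 1 U
  obtain ⟨ψ, hψ, hψ1, hHψ⟩ := exists_unit_eigen_sectorGroundEnergy
    (Model.hamiltonian_isHermitian hF) (a := a) (b := b) (by simpa using haL) (by simpa using hbL)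
  change (hubbardRingTV L 1 U).hamiltonian *ᵥ ψ =
    (((hubbardRingTV L 1 U).energy a b : ℝ) : ℂ) • ψ at hHψ
  set e := (hubbardRingTV L 1 U).energy a b with he
  obtain ⟨hn, hH⟩ := hubbardRingTV_sector_forms ha hb hKa hKb hd U hψ
  have hval : (star ψ ⬝ᵥ (hubbardRingTV L 1 U).hamiltonian *ᵥ ψ).re = e := by
    rw [hHψ, dotProduct_smul, hψ1, smul_eq_mul, mul_one, Complex.ofReal_re]
  have hone : normSqW (fun i j => coeffMatrix ψ (sa i) (sb j)) = 1 := by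
    rw [← hn, hψ1, Complex.one_re]
  rw [hH, hopForm_eq_hopR, dblForm_eq_dblR] at hval
  rw [normSqW_eq_nsqR] at hone
  have h1 := h (fun i j => (coeffMatrix ψ (sa i) (sb j)).re)
  have h2 := h (fun i j => (coeffMatrix ψ (sa i) (sb j)).im)
  have key : ((lo : ℚ) : ℝ) * (nsqR (fun i j => (coeffMatrix ψ (sa i) (sb j)).re) +
      nsqR (fun i j => (coeffMatrix ψ (sa i) (sb j)).im)) ≤ e := by linarith
  rw [hone, mul_one] at key
  exact key

/-- **LOWER rows by a kernel-checked Gram certificate.** With `0 < N`, `Ut = N · U` and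
`lo · N ≤ m`, a passing check `ddCheckP (bMatP Ka Kb d N Ut m) G s` (`0 < s`, any integer `G`)
proves `LowerRow (hubbardRingTV L 1 U) a b lo`. -/
theorem hubbardRingTV_lowerRow_of_ddCheckP (ha : IsSubsetEnum a sa) (hb : IsSubsetEnum b sb)
    (hKa : ∀ i i', hoppingMatrix (ringGraph L) 1 (sa i) (sa i') = (Ka i i' : ℂ))
    (hKb : ∀ j j', hoppingMatrix (ringGraph L) 1 (sb j) (sb j') = (Kb j j' : ℂ))
    (hd : ∀ i j, (sa i ∩ sb j).card = d i j) (haL : a ≤ L) (hbL : b ≤ L) (U lo : ℚ)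
    (N Ut m : ℤ) (G : Fin p × Fin q → Fin p × Fin q → ℤ) {s : ℤ} (hs : 0 < s) (hN : 0 < N)
    (hUt : (Ut : ℚ) = N * U) (hm : lo * N ≤ m)
    (hchk : ddCheckP (bMatP Ka Kb d N Ut m) G s = true) :
    LowerRow (hubbardRingTV L 1 U) a b lo := by
  refine hubbardRingTV_lowerRow_of_formBound ha hb hKa hKb hd haL hbL U lo fun x => ?_
  have h := form_lowerBound_of_ddCheckP Ka Kb d N Ut m G hs hchk x
  have hN' : (0 : ℝ) < (N : ℝ) := by exact_mod_cast hN
  have hUt' : ((Ut : ℤ) : ℝ) = ((N : ℤ) : ℝ) * ((U : ℚ) : ℝ) := by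
    have := congrArg (fun r : ℚ => (r : ℝ)) hUt
    push_cast at this
    exact this
  have hm' : ((lo : ℚ) : ℝ) * ((N : ℤ) : ℝ) ≤ ((m : ℤ) : ℝ) := by
    have := (Rat.cast_le (K := ℝ)).2 hm
    push_cast at this
    exact this
  have hx : 0 ≤ nsqR x := Finset.sum_nonneg fun i _ => Finset.sum_nonneg fun j _ => sq_nonneg _
  rw [hUt'] at h
  have h2 : ((lo : ℚ) : ℝ) * ((N : ℤ) : ℝ) * nsqR x ≤ ((m : ℤ) : ℝ) * nsqR x :=
    mul_le_mul_of_nonneg_right hm' hx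
  have h3 : ((N : ℤ) : ℝ) * (((lo : ℚ) : ℝ) * nsqR x) ≤
      ((N : ℤ) : ℝ) * (hopR Ka Kb x + ((U : ℚ) : ℝ) * dblR d x) := by
    linarith
  exact le_of_mul_le_mul_left h3 hN'

end Generic

/-! ## Literal tables: `L = 4`, sector `(2,2)` -/

section L4

/-- Enumeration of the two-element subsets of `Fin 4` (lexicographic). -/
def r4s2 : Fin 6 → Finset (Fin 4) := ![{0, 1}, {0, 2}, {0, 3}, {1, 2}, {1, 3}, {2, 3}]

/-- `r4s2` enumerates the `2`-subsets of `Fin 4`. -/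
theorem isSubsetEnum_r4s2 : IsSubsetEnum 2 r4s2 where
  inj i j h := (by decide : ∀ i j : Fin 6, r4s2 i = r4s2 j → i = j) i j h
  image_eq := by decide +kernel

/-- Hopping table of two spinless fermions on the 4-ring `0∼1∼2∼3∼0` in the enumeration `r4s2`
(`t = 1`, Jordan–Wigner signs of the order `0 < 1 < 2 < 3`: the bond `3∼0` hops over the occupied
sites in between), i.e. `hoppingMatrix (ringGraph 4) 1 (r4s2 i) (r4s2 j)`. -/
def r4K2 : Fin 6 → Fin 6 → ℤ :=
  ![![0, -1, 0, 0, 1, 0], ![-1, 0, -1, -1, 0, 1], ![0, -1, 0, 0, -1, 0], ![0, -1, 0, 0, -1, 0],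
    ![1, 0, -1, -1, 0, -1], ![0, 1, 0, 0, -1, 0]]

/-- Double occupancies `|r4s2 i ∩ r4s2 j|`. -/
def r4d22 : Fin 6 → Fin 6 → ℕ :=
  ![![2, 1, 1, 1, 1, 0], ![1, 2, 1, 1, 0, 1], ![1, 1, 2, 0, 1, 1], ![1, 1, 0, 2, 1, 1], ![1, 0, 1, 1, 2, 1],
    ![0, 1, 1, 1, 1, 2]]

/-- The table `r4K2` is minus the integer hopping entry `hopInt` of the 4-ring (kernel evaluation). -/
theorem hopInt_r4s2 : ∀ i j : Fin 6, hopInt (ringGraph 4) (r4s2 i) (r4s2 j) = -r4K2 i j := by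
  decide +kernel

/-- The table `r4d22` (kernel evaluation). -/
theorem card_r4s2_inter : ∀ i j : Fin 6, (r4s2 i ∩ r4s2 j).card = r4d22 i j := by decide +kernel

/-- Hopping entries of the 4-ring between two-element subsets. -/
theorem hoppingMatrix_r4s2 (i j : Fin 6) :
    hoppingMatrix (ringGraph 4) 1 (r4s2 i) (r4s2 j) = (r4K2 i j : ℂ) := by
  rw [hoppingMatrix_eq_cast, hopInt_r4s2]; push_cast; ring

/-- `L = 4`, sector `(2,2)`: UPPER certificate from an integer trial array. -/
theorem ringL4_upperCertificate_of_trial (U hi : ℚ) (v : Fin 6 → Fin 6 → ℤ) (hv : 0 < nsqZ v)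
    (hle : ((hopZ r4K2 r4K2 v : ℤ) : ℚ) + U * ((dblZ r4d22 v : ℤ) : ℚ) ≤ hi * ((nsqZ v : ℤ) : ℚ)) :
    UpperCertificate (hubbardRingTV 4 1 U) 2 2 hi :=
  hubbardRingTV_upperCertificate_of_trial isSubsetEnum_r4s2 isSubsetEnum_r4s2 hoppingMatrix_r4s2
    hoppingMatrix_r4s2 card_r4s2_inter U hi v hv hle

/-- `L = 4`, sector `(2,2)`: LOWER row from a kernel-checked Gram certificate of
`bMatP r4K2 r4K2 r4d22 N Ut m`. -/
theorem ringL4_lowerRow_of_ddCheckP (U lo : ℚ) (N Ut m : ℤ) (G : Fin 6 × Fin 6 → Fin 6 × Fin 6 → ℤ)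
    {s : ℤ} (hs : 0 < s) (hN : 0 < N) (hUt : (Ut : ℚ) = N * U) (hm : lo * N ≤ m)
    (hchk : ddCheckP (bMatP r4K2 r4K2 r4d22 N Ut m) G s = true) :
    LowerRow (hubbardRingTV 4 1 U) 2 2 lo :=
  hubbardRingTV_lowerRow_of_ddCheckP isSubsetEnum_r4s2 isSubsetEnum_r4s2 hoppingMatrix_r4s2
    hoppingMatrix_r4s2 card_r4s2_inter (by norm_num) (by norm_num) U lo N Ut m G hs hN hUt hm hchk

end L4

/-! ## Literal tables: `L = 6`, sector `(3,3)` -/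

section L6

/-- Enumeration of the three-element subsets of `Fin 6` (lexicographic). -/
def r6s3 : Fin 20 → Finset (Fin 6) :=
  ![{0, 1, 2}, {0, 1, 3}, {0, 1, 4}, {0, 1, 5}, {0, 2, 3}, {0, 2, 4}, {0, 2, 5}, {0, 3, 4}, {0, 3, 5}, {0, 4, 5},
    {1, 2, 3}, {1, 2, 4}, {1, 2, 5}, {1, 3, 4}, {1, 3, 5}, {1, 4, 5}, {2, 3, 4}, {2, 3, 5}, {2, 4, 5}, {3, 4, 5}]

/-- `r6s3` enumerates the `3`-subsets of `Fin 6`. -/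
theorem isSubsetEnum_r6s3 : IsSubsetEnum 3 r6s3 where
  inj i j h := (by decide : ∀ i j : Fin 20, r6s3 i = r6s3 j → i = j) i j h
  image_eq := by decide +kernel

/-- Hopping table of three spinless fermions on the 6-ring `0∼1∼⋯∼5∼0` in the enumeration `r6s3` (`t = 1`, Jordan–Wigner signs of `0 < ⋯ < 5`; with three fermions a boundary hop passes an even number of occupied sites, so every entry is `−1` or `0`), i.e. `hoppingMatrix (ringGraph 6) 1 (r6s3 i) (r6s3 j)`. -/
def r6K3 : Fin 20 → Fin 20 → ℤ :=
  ![![0, (-1), 0, 0, 0, 0, 0, 0, 0, 0, 0, 0, (-1), 0, 0, 0, 0, 0, 0, 0], ![(-1), 0, (-1), 0, (-1), 0, 0, 0, 0, 0, 0, 0, 0, 0, (-1), 0, 0, 0, 0, 0], ![0, (-1), 0, (-1), 0, (-1), 0, 0, 0, 0, 0, 0, 0, 0, 0, (-1), 0, 0, 0, 0], ![0, 0, (-1), 0, 0, 0, (-1), 0, 0, 0, 0, 0, 0, 0, 0, 0, 0, 0, 0, 0],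
    ![0, (-1), 0, 0, 0, (-1), 0, 0, 0, 0, (-1), 0, 0, 0, 0, 0, 0, (-1), 0, 0], ![0, 0, (-1), 0, (-1), 0, (-1), (-1), 0, 0, 0, (-1), 0, 0, 0, 0, 0, 0, (-1), 0], ![0, 0, 0, (-1), 0, (-1), 0, 0, (-1), 0, 0, 0, (-1), 0, 0, 0, 0, 0, 0, 0], ![0, 0, 0, 0, 0, (-1), 0, 0, (-1), 0, 0, 0, 0, (-1), 0, 0, 0, 0, 0, (-1)],
    ![0, 0, 0, 0, 0, 0, (-1), (-1), 0, (-1), 0, 0, 0, 0, (-1), 0, 0, 0, 0, 0], ![0, 0, 0, 0, 0, 0, 0, 0, (-1), 0, 0, 0, 0, 0, 0, (-1), 0, 0, 0, 0], ![0, 0, 0, 0, (-1), 0, 0, 0, 0, 0, 0, (-1), 0, 0, 0, 0, 0, 0, 0, 0], ![0, 0, 0, 0, 0, (-1), 0, 0, 0, 0, (-1), 0, (-1), (-1), 0, 0, 0, 0, 0, 0],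
    ![(-1), 0, 0, 0, 0, 0, (-1), 0, 0, 0, 0, (-1), 0, 0, (-1), 0, 0, 0, 0, 0], ![0, 0, 0, 0, 0, 0, 0, (-1), 0, 0, 0, (-1), 0, 0, (-1), 0, (-1), 0, 0, 0], ![0, (-1), 0, 0, 0, 0, 0, 0, (-1), 0, 0, 0, (-1), (-1), 0, (-1), 0, (-1), 0, 0], ![0, 0, (-1), 0, 0, 0, 0, 0, 0, (-1), 0, 0, 0, 0, (-1), 0, 0, 0, (-1), 0],
    ![0, 0, 0, 0, 0, 0, 0, 0, 0, 0, 0, 0, 0, (-1), 0, 0, 0, (-1), 0, 0], ![0, 0, 0, 0, (-1), 0, 0, 0, 0, 0, 0, 0, 0, 0, (-1), 0, (-1), 0, (-1), 0], ![0, 0, 0, 0, 0, (-1), 0, 0, 0, 0, 0, 0, 0, 0, 0, (-1), 0, (-1), 0, (-1)], ![0, 0, 0, 0, 0, 0, 0, (-1), 0, 0, 0, 0, 0, 0, 0, 0, 0, 0, (-1), 0]]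

/-- Double occupancies `|r6s3 i ∩ r6s3 j|`. -/
def r6d33 : Fin 20 → Fin 20 → ℕ :=
  ![![3, 2, 2, 2, 2, 2, 2, 1, 1, 1, 2, 2, 2, 1, 1, 1, 1, 1, 1, 0], ![2, 3, 2, 2, 2, 1, 1, 2, 2, 1, 2, 1, 1, 2, 2, 1, 1, 1, 0, 1], ![2, 2, 3, 2, 1, 2, 1, 2, 1, 2, 1, 2, 1, 2, 1, 2, 1, 0, 1, 1], ![2, 2, 2, 3, 1, 1, 2, 1, 2, 2, 1, 1, 2, 1, 2, 2, 0, 1, 1, 1],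
    ![2, 2, 1, 1, 3, 2, 2, 2, 2, 1, 2, 1, 1, 1, 1, 0, 2, 2, 1, 1], ![2, 1, 2, 1, 2, 3, 2, 2, 1, 2, 1, 2, 1, 1, 0, 1, 2, 1, 2, 1], ![2, 1, 1, 2, 2, 2, 3, 1, 2, 2, 1, 1, 2, 0, 1, 1, 1, 2, 2, 1], ![1, 2, 2, 1, 2, 2, 1, 3, 2, 2, 1, 1, 0, 2, 1, 1, 2, 1, 1, 2],
    ![1, 2, 1, 2, 2, 1, 2, 2, 3, 2, 1, 0, 1, 1, 2, 1, 1, 2, 1, 2], ![1, 1, 2, 2, 1, 2, 2, 2, 2, 3, 0, 1, 1, 1, 1, 2, 1, 1, 2, 2], ![2, 2, 1, 1, 2, 1, 1, 1, 1, 0, 3, 2, 2, 2, 2, 1, 2, 2, 1, 1], ![2, 1, 2, 1, 1, 2, 1, 1, 0, 1, 2, 3, 2, 2, 1, 2, 2, 1, 2, 1],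
    ![2, 1, 1, 2, 1, 1, 2, 0, 1, 1, 2, 2, 3, 1, 2, 2, 1, 2, 2, 1], ![1, 2, 2, 1, 1, 1, 0, 2, 1, 1, 2, 2, 1, 3, 2, 2, 2, 1, 1, 2], ![1, 2, 1, 2, 1, 0, 1, 1, 2, 1, 2, 1, 2, 2, 3, 2, 1, 2, 1, 2], ![1, 1, 2, 2, 0, 1, 1, 1, 1, 2, 1, 2, 2, 2, 2, 3, 1, 1, 2, 2],
    ![1, 1, 1, 0, 2, 2, 1, 2, 1, 1, 2, 2, 1, 2, 1, 1, 3, 2, 2, 2], ![1, 1, 0, 1, 2, 1, 2, 1, 2, 1, 2, 1, 2, 1, 2, 1, 2, 3, 2, 2], ![1, 0, 1, 1, 1, 2, 2, 1, 1, 2, 1, 2, 2, 1, 1, 2, 2, 2, 3, 2], ![0, 1, 1, 1, 1, 1, 1, 2, 2, 2, 1, 1, 1, 2, 2, 2, 2, 2, 2, 3]]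

/-- The table `r6K3` is minus the integer hopping entry `hopInt` of the 6-ring (kernel evaluation). -/
theorem hopInt_r6s3 : ∀ i j : Fin 20, hopInt (ringGraph 6) (r6s3 i) (r6s3 j) = -r6K3 i j := by
  decide +kernel

/-- The table `r6d33` (kernel evaluation). -/
theorem card_r6s3_inter : ∀ i j : Fin 20, (r6s3 i ∩ r6s3 j).card = r6d33 i j := by decide +kernel

/-- Hopping entries of the 6-ring between three-element subsets. -/
theorem hoppingMatrix_r6s3 (i j : Fin 20) :
    hoppingMatrix (ringGraph 6) 1 (r6s3 i) (r6s3 j) = (r6K3 i j : ℂ) := by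
  rw [hoppingMatrix_eq_cast, hopInt_r6s3]; push_cast; ring

/-- `L = 6`, sector `(3,3)`: UPPER certificate from an integer trial array. -/
theorem ringL6_upperCertificate_of_trial (U hi : ℚ) (v : Fin 20 → Fin 20 → ℤ) (hv : 0 < nsqZ v)
    (hle : ((hopZ r6K3 r6K3 v : ℤ) : ℚ) + U * ((dblZ r6d33 v : ℤ) : ℚ) ≤ hi * ((nsqZ v : ℤ) : ℚ)) :
    UpperCertificate (hubbardRingTV 6 1 U) 3 3 hi :=
  hubbardRingTV_upperCertificate_of_trial isSubsetEnum_r6s3 isSubsetEnum_r6s3 hoppingMatrix_r6s3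
    hoppingMatrix_r6s3 card_r6s3_inter U hi v hv hle

/-- `L = 6`, sector `(3,3)`: LOWER row from a kernel-checked Gram certificate of
`bMatP r6K3 r6K3 r6d33 N Ut m` (a `400 × 400` integer factor; not instantiated in the tree so far). -/
theorem ringL6_lowerRow_of_ddCheckP (U lo : ℚ) (N Ut m : ℤ)
    (G : Fin 20 × Fin 20 → Fin 20 × Fin 20 → ℤ) {s : ℤ} (hs : 0 < s) (hN : 0 < N)
    (hUt : (Ut : ℚ) = N * U) (hm : lo * N ≤ m)
    (hchk : ddCheckP (bMatP r6K3 r6K3 r6d33 N Ut m) G s = true) :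
    LowerRow (hubbardRingTV 6 1 U) 3 3 lo :=
  hubbardRingTV_lowerRow_of_ddCheckP isSubsetEnum_r6s3 isSubsetEnum_r6s3 hoppingMatrix_r6s3
    hoppingMatrix_r6s3 card_r6s3_inter (by norm_num) (by norm_num) U lo N Ut m G hs hN hUt hm hchk

end L6

end Summit.Ventures.CertifiedQuantumChemistry
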